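import Literature.NumberTheory.EllipticCurves.ModularSymbolRepProofs
import Literature.NumberTheory.EllipticCurves.KleinJRealValues

/-!
# `ManinStokes` (stmt-KontsevichZagierPeriods-5277): geometry of the `(2,3,∞)`-tile under Klein's `j`

Support file (prover-owned, `--supports stmt-KontsevichZagierPeriods-5277`). The reduction
`three_term_of_tiles` (`HeckeMultiplicityOneManinStokesTiles.lean`) leaves, as the analytic content of
Manin's three-term relation inside the Kontsevich–Zagier calculus, Cauchy's theorem for the tile
`τ₀ = {0 < re z < 1/2, |z| > 1}` written in the algebraic coordinate `u = j`. This file supplies the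
geometry of `j` on the CLOSED HALF FUNDAMENTAL DOMAIN `{z ∈ 𝒟 | 0 ≤ re z}` (the closure of `τ₀` in `ℍ`):

* `kleinJ_injOn_halfFd` — **`j` is injective on `{z ∈ 𝒟 | 0 ≤ re z}`** (Mathlib's classification
  `ModularGroup.cases_of_mem_fd_smul_mem_fd` of the pairs `z, g·z ∈ 𝒟` and the orbit criterion
  `kleinJ_eq_kleinJ_iff` of the tree);
* `kleinJ_im_eq_zero_of_norm_eq_one` — `j` is real on the unit circle (`j(z) = j(Sz) = j(−z̄) = conj j(z)`),
  together with the tree's `kleinJ_im_eq_zero` (`re z ∈ ½ℤ`) this makes `j` real on all three edges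
  `A = {it}`, `B = {e^{iθ}}`, `C = {1/2 + it}` of the tile;
* the edge `B`: `θ ↦ re j(e^{iθ})` is a strictly increasing bijection of `[π/3, π/2]` onto `[0, 1728]`
  (`strictMonoOn_kleinJ_ofComplex_exp_re`, `exists_kleinJ_ofComplex_exp_re_eq`);
* (the edge `C = {1/2 + it}` is treated in the companion file `…ManinStokesTileEdgeC.lean`).

References: J.-P. Serre, *A Course in Arithmetic* (1973), VII §1–§3; F. Diamond, J. Shurman, *A First
Course in Modular Forms* (2005), §2.3–2.4. No definitions, no named facts.
-/

noncomputable section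

open scoped MatrixGroups ModularForm Modular
open CongruenceSubgroup Complex Set Filter
open UpperHalfPlane hiding I
open Literature.NumberTheory.EllipticCurves Literature.NumberTheory.EllipticCurves.ModularForms

namespace Summit.KontsevichZagierPeriods.HeckeMultiplicityOne.ManinStokes

/-! ### Injectivity of `j` on the closed half fundamental domain -/

/-- `S·ρ = T·ρ = 1 + ρ` (`(T⁻¹S)·ρ = ρ`, Mathlib `ModularGroup.stabilizer_ρ`). [folklore] -/
theorem S_smul_rho : ModularGroup.S • UpperHalfPlane.ρ = ModularGroup.T • UpperHalfPlane.ρ := by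
  have h : (ModularGroup.T⁻¹ * ModularGroup.S) • UpperHalfPlane.ρ = UpperHalfPlane.ρ :=
    ModularGroup.stabilizer_ρ.mpr (by simp)
  rw [mul_smul, inv_smul_eq_iff] at h
  exact h

/-- `(ST)·ρ = ρ` (Mathlib `ModularGroup.stabilizer_ρ`). [folklore] -/
theorem S_mul_T_smul_rho : (ModularGroup.S * ModularGroup.T) • UpperHalfPlane.ρ = UpperHalfPlane.ρ :=
  ModularGroup.stabilizer_ρ.mpr (by simp)

/-- For `|z| = 1`, `S·z = −z̄`: real part `−re z`. [folklore] -/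
theorem re_S_smul_of_norm_eq_one {z : ℍ} (hz : ‖(z : ℂ)‖ = 1) :
    (ModularGroup.S • z).re = -z.re := by
  have h1 : ((ModularGroup.S • z : ℍ) : ℂ) = (-(z : ℂ))⁻¹ := by
    rw [UpperHalfPlane.modular_S_smul]
  have hn : Complex.normSq (z : ℂ) = 1 := by
    rw [Complex.normSq_eq_norm_sq, hz, one_pow]
  rw [← UpperHalfPlane.coe_re, h1, Complex.inv_re, Complex.normSq_neg, hn]
  simp

/-- For `|z| = 1`, `S·z = −z̄`: imaginary part `im z`. [folklore] -/
theorem im_S_smul_of_norm_eq_one {z : ℍ} (hz : ‖(z : ℂ)‖ = 1) :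
    (ModularGroup.S • z).im = z.im := by
  have h1 : ((ModularGroup.S • z : ℍ) : ℂ) = (-(z : ℂ))⁻¹ := by
    rw [UpperHalfPlane.modular_S_smul]
  have hn : Complex.normSq (z : ℂ) = 1 := by
    rw [Complex.normSq_eq_norm_sq, hz, one_pow]
  rw [← UpperHalfPlane.coe_im, h1, Complex.inv_im, Complex.normSq_neg, hn]
  simp

/-- **`j` is injective on the closed half fundamental domain `{z ∈ 𝒟 | 0 ≤ re z}`.** Two points with
the same `j` are `SL₂(ℤ)`-equivalent (`kleinJ_eq_kleinJ_iff`); by Mathlib's classification of the pairs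
`z, g·z ∈ 𝒟` (`ModularGroup.cases_of_mem_fd_smul_mem_fd`) the only identifications of `𝒟` are
`z ∼ z ± 1` on the vertical sides and `z ∼ Sz = −z̄` on the arc, none of which relates two distinct
points with `re ≥ 0`. [cite: DiamondShurman2005, §2.3 Lemma 2.3.1–Prop. 2.3.2] -/
theorem kleinJ_injOn_halfFd : InjOn kleinJ {z : ℍ | z ∈ 𝒟 ∧ 0 ≤ z.re} := by
  rintro z ⟨hz, hz0⟩ w ⟨hw, hw0⟩ hj
  obtain ⟨γ, hγ⟩ := kleinJ_eq_kleinJ_iff.mp hj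
  have hw' : γ • z ∈ 𝒟 := hγ ▸ hw
  have key : ∀ X : SL(2, ℤ), (γ = X ∨ γ = -X) → w = X • z := by
    rintro X (rfl | rfl)
    · exact hγ.symm
    · rw [← hγ, ModularGroup.SL_neg_smul]
  have hρre : UpperHalfPlane.ρ.re = -1 / 2 := rfl
  have hTρ : ModularGroup.T • UpperHalfPlane.ρ = (1 : ℝ) +ᵥ UpperHalfPlane.ρ :=
    UpperHalfPlane.modular_T_smul _
  rcases ModularGroup.cases_of_mem_fd_smul_mem_fd hz hw' with
    h | ⟨h, hre⟩ | ⟨h, hre⟩ | ⟨h, hnorm⟩ | ⟨h, hzρ⟩ | ⟨h, hzρ⟩ | ⟨h, hzρ⟩ | ⟨h, hzρ⟩ | ⟨h, hzρ⟩ |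
      ⟨h, hzρ⟩
  · rw [key 1 h, one_smul]
  · exfalso; linarith
  · exfalso
    have := key _ h
    rw [this, ModularGroup.re_T_inv_smul] at hw0
    linarith
  · have hw1 := key _ h
    have hre : w.re = -z.re := by rw [hw1, re_S_smul_of_norm_eq_one hnorm]
    have him : w.im = z.im := by rw [hw1, im_S_smul_of_norm_eq_one hnorm]
    have hz00 : z.re = 0 := by linarith
    apply UpperHalfPlane.ext
    apply Complex.ext
    · rw [UpperHalfPlane.coe_re, UpperHalfPlane.coe_re, hre, hz00, neg_zero]
    · rw [UpperHalfPlane.coe_im, UpperHalfPlane.coe_im, him]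
  · -- `γ = ±TS`, `z = 1 + ρ = T·ρ`: `TS·Tρ = T·(ST·ρ) = Tρ`
    rw [key _ h, hzρ, ← hTρ, ← mul_smul, mul_assoc, mul_smul ModularGroup.T, S_mul_T_smul_rho]
  · -- `γ = ±T⁻¹ST⁻¹`: `w = T⁻¹·S·ρ = T⁻¹·T·ρ = ρ`, `re w = -1/2 < 0`
    exfalso
    have hw1 := key _ h
    rw [hzρ, ← hTρ, mul_smul, mul_smul, inv_smul_smul, S_smul_rho, inv_smul_smul] at hw1
    rw [hw1, hρre] at hw0
    linarith
  · -- `γ = ±ST⁻¹`: `w = S·ρ = T·ρ = z`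
    rw [key _ h, hzρ, ← hTρ, mul_smul, inv_smul_smul, S_smul_rho]
  · exfalso; rw [hzρ, hρre] at hz0; linarith
  · exfalso; rw [hzρ, hρre] at hz0; linarith
  · exfalso; rw [hzρ, hρre] at hz0; linarith

/-! ### `j` is real on the unit circle -/

/-- **`j(−τ̄) = conj j(τ)`**: the `q`-expansion of `q·j` has integer coefficients (`hasSum_formalXJ`) and
`q(−τ̄) = conj q(τ)`. [folklore] -/
theorem kleinJ_negConjPt (τ : ℍ) : kleinJ (negConjPt τ) = (starRingEnd ℂ) (kleinJ τ) := by
  have h := apply_negConjPt_of_hasSum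
    (φ := fun τ : ℍ => Function.Periodic.qParam 1 (τ : ℂ) * kleinJ τ)
    (c := fun n => ((PowerSeries.coeff n formalXJ : ℤ) : ℂ)) hasSum_formalXJ
    (fun n => map_intCast _ _) τ
  simp only [map_mul, qParam_negConjPt] at h
  exact mul_left_cancel₀ ((map_ne_zero _).mpr (Function.Periodic.qParam_ne_zero _)) h

/-- On the unit circle `S·z = −z̄`. [folklore] -/
theorem S_smul_eq_negConjPt_of_norm_eq_one {z : ℍ} (hz : ‖(z : ℂ)‖ = 1) :
    ModularGroup.S • z = negConjPt z := by
  apply UpperHalfPlane.ext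
  apply Complex.ext
  · rw [UpperHalfPlane.coe_re, re_S_smul_of_norm_eq_one hz, coe_negConjPt]
    simp
  · rw [UpperHalfPlane.coe_im, im_S_smul_of_norm_eq_one hz, coe_negConjPt]
    simp

/-- **`j` is real on the unit circle**: `j(z) = j(Sz) = j(−z̄) = conj j(z)` for `|z| = 1`. [folklore] -/
theorem kleinJ_im_eq_zero_of_norm_eq_one {z : ℍ} (hz : ‖(z : ℂ)‖ = 1) : (kleinJ z).im = 0 := by
  have h : kleinJ z = (starRingEnd ℂ) (kleinJ z) := by
    conv_lhs => rw [← kleinJ_smul ModularGroup.S z, S_smul_eq_negConjPt_of_norm_eq_one hz,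
      kleinJ_negConjPt]
  exact Complex.conj_eq_iff_im.mp h.symm

/-! ### The edge `B`: the arc `θ ↦ e^{iθ}`, `π/3 ≤ θ ≤ π/2`, from `1 + ρ` to `i` -/

/-- `e^{iθ}` lies in the upper half plane for `0 < θ < π`. [folklore] -/
theorem im_exp_mul_I_pos {θ : ℝ} (h0 : 0 < θ) (hπ : θ < Real.pi) : 0 < (Complex.exp (θ * I)).im := by
  rw [Complex.exp_ofReal_mul_I_im]
  exact Real.sin_pos_of_pos_of_lt_pi h0 hπ

/-- `(π/3, π/2] ⊆ (0, π)`-type bounds used below. [folklore] -/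
theorem pos_and_lt_pi_of_mem_Icc {θ : ℝ} (h : θ ∈ Icc (Real.pi / 3) (Real.pi / 2)) :
    0 < θ ∧ θ < Real.pi := by
  have := Real.pi_pos
  constructor <;> linarith [h.1, h.2]

/-- The point `e^{iθ}` of `ℍ` has norm one (`0 < θ < π`). [folklore] -/
theorem norm_coe_ofComplex_exp {θ : ℝ} (h0 : 0 < θ) (hπ : θ < Real.pi) :
    ‖((ofComplex (Complex.exp (θ * I)) : ℍ) : ℂ)‖ = 1 := by
  rw [coe_ofComplex (im_exp_mul_I_pos h0 hπ), Complex.norm_exp_ofReal_mul_I]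

/-- The point `e^{iθ}` of `ℍ` has real part `cos θ` (`0 < θ < π`). [folklore] -/
theorem re_ofComplex_exp {θ : ℝ} (h0 : 0 < θ) (hπ : θ < Real.pi) :
    (ofComplex (Complex.exp (θ * I)) : ℍ).re = Real.cos θ := by
  rw [← UpperHalfPlane.coe_re, coe_ofComplex (im_exp_mul_I_pos h0 hπ), Complex.exp_ofReal_mul_I_re]

/-- For `π/3 ≤ θ ≤ π/2` the point `e^{iθ}` lies in the closed half fundamental domain
`{z ∈ 𝒟 | 0 ≤ re z}` (`re = cos θ ∈ [0, 1/2]`, `|z| = 1`). [folklore] -/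
theorem ofComplex_exp_mem_halfFd {θ : ℝ} (h : θ ∈ Icc (Real.pi / 3) (Real.pi / 2)) :
    (ofComplex (Complex.exp (θ * I)) : ℍ) ∈ {z : ℍ | z ∈ 𝒟 ∧ 0 ≤ z.re} := by
  obtain ⟨h0, hπ⟩ := pos_and_lt_pi_of_mem_Icc h
  have hre := re_ofComplex_exp h0 hπ
  have hcos0 : 0 ≤ Real.cos θ := Real.cos_nonneg_of_mem_Icc ⟨by linarith, h.2⟩
  have hcos : Real.cos θ ≤ 1 / 2 := by
    rw [← Real.cos_pi_div_three]
    exact Real.cos_le_cos_of_nonneg_of_le_pi (by linarith [Real.pi_pos]) (by linarith) h.1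
  refine ⟨⟨?_, ?_⟩, ?_⟩
  · rw [Complex.normSq_eq_norm_sq, norm_coe_ofComplex_exp h0 hπ, one_pow]
  · rw [hre, abs_of_nonneg hcos0]; exact hcos
  · rw [hre]; exact hcos0

/-- `j(e^{iθ})` is real. [folklore] -/
theorem kleinJ_ofComplex_exp_im {θ : ℝ} (h0 : 0 < θ) (hπ : θ < Real.pi) :
    (kleinJ (ofComplex (Complex.exp (θ * I)))).im = 0 :=
  kleinJ_im_eq_zero_of_norm_eq_one (norm_coe_ofComplex_exp h0 hπ)

/-- `e^{iπ/2} = i` as a point of `ℍ`. [folklore] -/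
theorem ofComplex_exp_pi_div_two : (ofComplex (Complex.exp ((Real.pi / 2 : ℝ) * I)) : ℍ) =
    UpperHalfPlane.I := by
  apply UpperHalfPlane.ext
  rw [coe_ofComplex (im_exp_mul_I_pos (by positivity) (by linarith [Real.pi_pos])),
    Complex.exp_mul_I, ← Complex.ofReal_cos, ← Complex.ofReal_sin, Real.cos_pi_div_two,
    Real.sin_pi_div_two]
  simp

/-- `e^{iπ/3} = 1 + ρ = T·ρ` as a point of `ℍ`. [folklore] -/
theorem ofComplex_exp_pi_div_three : (ofComplex (Complex.exp ((Real.pi / 3 : ℝ) * I)) : ℍ) =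
    ModularGroup.T • UpperHalfPlane.ρ := by
  apply UpperHalfPlane.ext
  rw [coe_ofComplex (im_exp_mul_I_pos (by positivity) (by linarith [Real.pi_pos])),
    Complex.exp_mul_I, ← Complex.ofReal_cos, ← Complex.ofReal_sin, Real.cos_pi_div_three,
    Real.sin_pi_div_three, UpperHalfPlane.modular_T_smul, UpperHalfPlane.coe_vadd]
  apply Complex.ext
  · simp [UpperHalfPlane.ρ]; norm_num
  · simp [UpperHalfPlane.ρ]

/-- `j(i) = 1728` on the arc: `re j(e^{iπ/2}) = 1728`. [folklore] -/
theorem kleinJ_exp_pi_div_two_re : (kleinJ (ofComplex (Complex.exp ((Real.pi / 2 : ℝ) * I)))).re =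
    1728 := by
  rw [ofComplex_exp_pi_div_two, kleinJ_I]; norm_num

/-- `j(1 + ρ) = 0` on the arc: `re j(e^{iπ/3}) = 0`. [folklore] -/
theorem kleinJ_exp_pi_div_three_re : (kleinJ (ofComplex (Complex.exp ((Real.pi / 3 : ℝ) * I)))).re =
    0 := by
  rw [ofComplex_exp_pi_div_three, kleinJ_smul, kleinJ_rho]; simp

/-- `θ ↦ j(e^{iθ})` is continuous on `(0, π)`. [folklore] -/
theorem continuousOn_kleinJ_ofComplex_exp :
    ContinuousOn (fun θ : ℝ => kleinJ (ofComplex (Complex.exp (θ * I)))) (Ioo 0 Real.pi) := by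
  have h1 : ContinuousOn (kleinJ ∘ ofComplex) {z : ℂ | 0 < z.im} :=
    (UpperHalfPlane.mdifferentiable_iff.mp mdifferentiable_kleinJ).continuousOn
  refine h1.comp (by fun_prop) fun θ hθ => ?_
  exact im_exp_mul_I_pos hθ.1 hθ.2

/-- **`θ ↦ re j(e^{iθ})` is injective on `[π/3, π/2]`** (injectivity of `j` on the half domain and of
`θ ↦ cos θ` on `[0, π]`). [folklore] -/
theorem injOn_kleinJ_ofComplex_exp_re :
    InjOn (fun θ : ℝ => (kleinJ (ofComplex (Complex.exp (θ * I)))).re)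
      (Icc (Real.pi / 3) (Real.pi / 2)) := by
  intro θ hθ θ' hθ' h
  obtain ⟨h0, hπ⟩ := pos_and_lt_pi_of_mem_Icc hθ
  obtain ⟨h0', hπ'⟩ := pos_and_lt_pi_of_mem_Icc hθ'
  have hj : kleinJ (ofComplex (Complex.exp (θ * I))) = kleinJ (ofComplex (Complex.exp (θ' * I))) :=
    Complex.ext h (by rw [kleinJ_ofComplex_exp_im h0 hπ, kleinJ_ofComplex_exp_im h0' hπ'])
  have hpt := kleinJ_injOn_halfFd (ofComplex_exp_mem_halfFd hθ) (ofComplex_exp_mem_halfFd hθ') hj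
  have hcos : Real.cos θ = Real.cos θ' := by
    rw [← re_ofComplex_exp h0 hπ, ← re_ofComplex_exp h0' hπ', hpt]
  exact Real.injOn_cos ⟨h0.le, hπ.le⟩ ⟨h0'.le, hπ'.le⟩ hcos

/-- **`θ ↦ re j(e^{iθ})` is strictly increasing on `[π/3, π/2]`, from `0` to `1728`.** [folklore] -/
theorem strictMonoOn_kleinJ_ofComplex_exp_re :
    StrictMonoOn (fun θ : ℝ => (kleinJ (ofComplex (Complex.exp (θ * I)))).re)
      (Icc (Real.pi / 3) (Real.pi / 2)) := by
  have hπ := Real.pi_pos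
  refine ContinuousOn.strictMonoOn_of_injOn_Icc (by linarith) ?_ ?_ injOn_kleinJ_ofComplex_exp_re
  · rw [kleinJ_exp_pi_div_three_re, kleinJ_exp_pi_div_two_re]; norm_num
  · exact (Complex.continuous_re.comp_continuousOn continuousOn_kleinJ_ofComplex_exp).mono
      fun θ hθ => pos_and_lt_pi_of_mem_Icc hθ

/-- **The arc `B` covers `[0, 1728]`**: every `u ∈ [0, 1728]` is `re j(e^{iθ})` for a unique
`θ ∈ [π/3, π/2]` (intermediate value theorem). [folklore] -/
theorem exists_kleinJ_ofComplex_exp_re_eq {u : ℝ} (hu : u ∈ Icc (0 : ℝ) 1728) :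
    ∃ θ ∈ Icc (Real.pi / 3) (Real.pi / 2), (kleinJ (ofComplex (Complex.exp (θ * I)))).re = u := by
  have hπ := Real.pi_pos
  have hcont : ContinuousOn (fun θ : ℝ => (kleinJ (ofComplex (Complex.exp (θ * I)))).re)
      (Icc (Real.pi / 3) (Real.pi / 2)) :=
    (Complex.continuous_re.comp_continuousOn continuousOn_kleinJ_ofComplex_exp).mono
      fun θ hθ => pos_and_lt_pi_of_mem_Icc hθ
  have := intermediate_value_Icc (by linarith) hcont
  rw [kleinJ_exp_pi_div_three_re, kleinJ_exp_pi_div_two_re] at this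
  exact this hu

end Summit.KontsevichZagierPeriods.HeckeMultiplicityOne.ManinStokes
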